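import Summits.SmoothPoincare4.SmoothPoincare4.Theorems.EntropyRungSubcylindricalRecognitionConeAnnulusArithmeticAux2
import Mathlib.Analysis.Complex.ExponentialBounds
import HarnessLib

/-!
# Gaussian annulus arithmetic in `ℝ⁴` — the integral estimates

Helper file for the stub `stub_coneAnnulusArithmetic` of line `ancient-sphere-rigidity`
(crux `EntropyRung.SubcylindricalRecognition`, stmt-SmoothPoincare4-10869), continuing
`…ConeAnnulusArithmeticAux.lean`, `…ConeAnnulusArithmeticAux2.lean`.

With `w(s) = e^{-s/8τ} T(s/(2ε²) - 1) T(3 - 4s/r'²)`, `A = {ε < |y| < r'} ⊂ ℝ⁴` and Lebesgue measure: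
* `∫_{ℝ⁴} e^{-b|y|²} dy = π²/b²` (`integral_gaussian_four`, from Mathlib's
  `GaussianFourier.integral_rexp_neg_mul_sq_norm`) and integrability;
* `I0_le`:  `∫_A w(|y|²)² ≤ 16π²τ²`;
* `I0_ge`:  `16π²τ² - e·16π²ε⁴ - e^{-r'²/16τ}·64π²τ² ≤ ∫_A w(|y|²)²`
  (the integrand vanishes off `A`, so this is an integral over `ℝ⁴`);
* `I2_le`:  `∫_A -w² log w² ≤ (16π²τ²/(1-t)² - 16π²τ²)/t + e·16π²ε⁴ + e^{-r'²/16τ}·64π²τ²`;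
* `I1_le`:  `∫_A 16|y|² w'(|y|²)² ≤ τ⁻¹(16π²τ²/(1-t)² - 16π²τ²)/t + K₁ e 16π²ε⁴ + K₂ e π² r'⁴`;
* the error budget of the shell terms (`budget_inner`, `budget_outer`): under
  `ε² ≤ cτ`, `τ ≤ c r'²`, `0 < c ≤ 1/4` every error is `≤ const · c · 16π²τ²`.
Upper bounds use `integral_mono_of_nonneg` against an integrable combination of Gaussians, so no
integrability of the complicated integrands is needed.

All statements are [folklore]; no named facts are used.
-/

-- the prescribed namespace `Summit.<P>.<Sub>.…` duplicates `SmoothPoincare4` (P = Sub)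
set_option linter.dupNamespace false

noncomputable section

open scoped Topology
open Set Real

namespace Summit.SmoothPoincare4.SmoothPoincare4.Theorems.SubcylindricalRecognition.AncientSphereRigidity

namespace ConeAnnulus

/-! ## Gaussian integrals over `ℝ⁴` -/

open MeasureTheory

/-- `∫_{ℝ⁴} e^{-b|y|²} dy = π²/b²` (`b > 0`). [folklore] -/
theorem integral_gaussian_four {b : ℝ} (hb : 0 < b) :
    ∫ y : EuclideanSpace ℝ (Fin 4), exp (-b * ‖y‖ ^ 2) = π ^ 2 / b ^ 2 := by
  have h := GaussianFourier.integral_rexp_neg_mul_sq_norm (V := EuclideanSpace ℝ (Fin 4)) hb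
  rw [h, finrank_euclideanSpace, Fintype.card_fin]
  have e : ((4 : ℕ) : ℝ) / 2 = (2 : ℕ) := by norm_num
  rw [e, rpow_natCast, div_pow]

/-- The Gaussian `e^{-b|y|²}` is integrable on `ℝ⁴` (`b > 0`). [folklore] -/
theorem integrable_gaussian_four {b : ℝ} (hb : 0 < b) :
    Integrable (fun y : EuclideanSpace ℝ (Fin 4) ↦ exp (-b * ‖y‖ ^ 2)) := by
  by_contra h
  have h0 := integral_undef h
  rw [integral_gaussian_four hb] at h0
  have : 0 < π ^ 2 / b ^ 2 := by positivity
  linarith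

/-- The annulus `{ε < |y| < r'}` is measurable. [folklore] -/
theorem measurableSet_annulus (ε r' : ℝ) :
    MeasurableSet (Metric.ball (0 : EuclideanSpace ℝ (Fin 4)) r' \ Metric.closedBall 0 ε) :=
  measurableSet_ball.diff measurableSet_closedBall

/-! ## The four integral estimates -/

/-- `I₀ ≤ 16π²τ²`. [folklore] -/
theorem I0_le {τ : ℝ} (ε r' : ℝ) (hτ : 0 < τ) :
    ∫ y in (Metric.ball (0 : EuclideanSpace ℝ (Fin 4)) r' \ Metric.closedBall 0 ε),
        (exp (-‖y‖ ^ 2 / (8 * τ)) *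
          (smoothTransition (‖y‖ ^ 2 / (2 * ε ^ 2) - 1) *
            smoothTransition (3 - 4 * ‖y‖ ^ 2 / r' ^ 2))) ^ 2 ≤ 16 * π ^ 2 * τ ^ 2 := by
  have hb : 0 < 1 / (4 * τ) := by positivity
  have hG := integrable_gaussian_four hb
  calc _ ≤ ∫ y in (Metric.ball (0 : EuclideanSpace ℝ (Fin 4)) r' \ Metric.closedBall 0 ε),
        exp (-(1 / (4 * τ)) * ‖y‖ ^ 2) := by
        apply integral_mono_of_nonneg
        · exact ae_of_all _ (fun y ↦ sq_nonneg _)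
        · exact hG.integrableOn
        · exact ae_of_all _ (fun y ↦ profile_sq_le' τ ε r' (‖y‖ ^ 2))
    _ ≤ ∫ y : EuclideanSpace ℝ (Fin 4), exp (-(1 / (4 * τ)) * ‖y‖ ^ 2) :=
        setIntegral_le_integral hG (ae_of_all _ (fun y ↦ (exp_pos _).le))
    _ = 16 * π ^ 2 * τ ^ 2 := by
        rw [integral_gaussian_four hb]; field_simp; ring

/-- The squared profile `w(|y|²)²` is integrable on `ℝ⁴`. [folklore] -/
theorem integrable_profile_sq {τ : ℝ} (ε r' : ℝ) (hτ : 0 < τ) :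
    Integrable (fun y : EuclideanSpace ℝ (Fin 4) ↦
      (exp (-‖y‖ ^ 2 / (8 * τ)) *
        (smoothTransition (‖y‖ ^ 2 / (2 * ε ^ 2) - 1) *
          smoothTransition (3 - 4 * ‖y‖ ^ 2 / r' ^ 2))) ^ 2) := by
  have hb : 0 < 1 / (4 * τ) := by positivity
  have hcont : Continuous (fun y : EuclideanSpace ℝ (Fin 4) ↦
      (exp (-‖y‖ ^ 2 / (8 * τ)) *
        (smoothTransition (‖y‖ ^ 2 / (2 * ε ^ 2) - 1) *
          smoothTransition (3 - 4 * ‖y‖ ^ 2 / r' ^ 2))) ^ 2) :=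
    ((continuous_profile τ ε r').comp (continuous_norm.pow 2)).pow 2
  refine (integrable_gaussian_four hb).mono' hcont.aestronglyMeasurable (ae_of_all _ (fun y ↦ ?_))
  rw [Real.norm_eq_abs, abs_of_nonneg (sq_nonneg _)]
  exact profile_sq_le' τ ε r' (‖y‖ ^ 2)

/-- The squared profile vanishes off the annulus `{ε < |y| < r'}`. [folklore] -/
theorem profile_sq_eq_zero_of_not_mem {τ ε r' : ℝ} (hε : 0 < ε) (hr : 0 < r')
    (y : EuclideanSpace ℝ (Fin 4))
    (hy : y ∉ Metric.ball (0 : EuclideanSpace ℝ (Fin 4)) r' \ Metric.closedBall 0 ε) :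
    (exp (-‖y‖ ^ 2 / (8 * τ)) *
        (smoothTransition (‖y‖ ^ 2 / (2 * ε ^ 2) - 1) *
          smoothTransition (3 - 4 * ‖y‖ ^ 2 / r' ^ 2))) ^ 2 = 0 := by
  rw [Set.mem_sdiff, mem_ball_zero_iff, mem_closedBall_zero_iff, not_and, not_not] at hy
  rcases le_or_gt r' ‖y‖ with h | h
  · rw [profile_eq_zero_of_ge (τ := τ) (ε := ε) hr]
    · simp
    · nlinarith [norm_nonneg y]
  · rw [profile_eq_zero_of_le (τ := τ) (r' := r') hε]
    · simp
    · have := hy h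
      nlinarith [norm_nonneg y]

/-- `16π²τ² - e · 16π²ε⁴ - e^{-r'²/16τ} · 64π²τ² ≤ I₀`. [folklore] -/
theorem I0_ge {τ ε r' : ℝ} (hτ : 0 < τ) (hε : 0 < ε) (hr : 0 < r') :
    16 * π ^ 2 * τ ^ 2 - exp 1 * (16 * π ^ 2 * ε ^ 4) -
        exp (-r' ^ 2 / (16 * τ)) * (64 * π ^ 2 * τ ^ 2) ≤
      ∫ y in (Metric.ball (0 : EuclideanSpace ℝ (Fin 4)) r' \ Metric.closedBall 0 ε),
        (exp (-‖y‖ ^ 2 / (8 * τ)) *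
          (smoothTransition (‖y‖ ^ 2 / (2 * ε ^ 2) - 1) *
            smoothTransition (3 - 4 * ‖y‖ ^ 2 / r' ^ 2))) ^ 2 := by
  rw [setIntegral_eq_integral_of_forall_compl_eq_zero
    (fun y hy ↦ profile_sq_eq_zero_of_not_mem hε hr y hy)]
  have hb1 : 0 < 1 / (4 * τ) := by positivity
  have hb2 : 0 < 1 / (4 * ε ^ 2) := by positivity
  have hb3 : 0 < 1 / (8 * τ) := by positivity
  have hG1 := integrable_gaussian_four hb1
  have hG2 := integrable_gaussian_four hb2
  have hG3 := integrable_gaussian_four hb3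
  have v1 : π ^ 2 / (1 / (4 * τ)) ^ 2 = 16 * π ^ 2 * τ ^ 2 := by field_simp; ring
  have v2 : π ^ 2 / (1 / (4 * ε ^ 2)) ^ 2 = 16 * π ^ 2 * ε ^ 4 := by field_simp; ring
  have v3 : π ^ 2 / (1 / (8 * τ)) ^ 2 = 64 * π ^ 2 * τ ^ 2 := by field_simp; ring
  calc 16 * π ^ 2 * τ ^ 2 - exp 1 * (16 * π ^ 2 * ε ^ 4) -
        exp (-r' ^ 2 / (16 * τ)) * (64 * π ^ 2 * τ ^ 2)
      = ∫ y : EuclideanSpace ℝ (Fin 4), (exp (-(1 / (4 * τ)) * ‖y‖ ^ 2) -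
          exp 1 * exp (-(1 / (4 * ε ^ 2)) * ‖y‖ ^ 2) -
          exp (-r' ^ 2 / (16 * τ)) * exp (-(1 / (8 * τ)) * ‖y‖ ^ 2)) := by
        rw [integral_sub (hG1.sub' (hG2.const_mul _)) (hG3.const_mul _),
          integral_sub hG1 (hG2.const_mul _), integral_const_mul, integral_const_mul,
          integral_gaussian_four hb1, integral_gaussian_four hb2, integral_gaussian_four hb3,
          v1, v2, v3]
    _ ≤ _ := by
        apply integral_mono ((hG1.sub' (hG2.const_mul _)).sub' (hG3.const_mul _))
          (integrable_profile_sq ε r' hτ)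
        intro y
        exact profile_sq_ge' hτ hε hr (sq_nonneg ‖y‖)

/-- `I₂ ≤ (16π²τ²/(1-t)² - 16π²τ²)/t + e · 16π²ε⁴ + e^{-r'²/16τ} · 64π²τ²`. [folklore] -/
theorem I2_le {t τ ε r' : ℝ} (ht : 0 < t) (ht1 : t < 1) (hτ : 0 < τ) (hε : 0 < ε) (hr : 0 < r') :
    ∫ y in (Metric.ball (0 : EuclideanSpace ℝ (Fin 4)) r' \ Metric.closedBall 0 ε),
        -((exp (-‖y‖ ^ 2 / (8 * τ)) *
            (smoothTransition (‖y‖ ^ 2 / (2 * ε ^ 2) - 1) *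
              smoothTransition (3 - 4 * ‖y‖ ^ 2 / r' ^ 2))) ^ 2 *
          log ((exp (-‖y‖ ^ 2 / (8 * τ)) *
            (smoothTransition (‖y‖ ^ 2 / (2 * ε ^ 2) - 1) *
              smoothTransition (3 - 4 * ‖y‖ ^ 2 / r' ^ 2))) ^ 2)) ≤
      (16 * π ^ 2 * τ ^ 2 / (1 - t) ^ 2 - 16 * π ^ 2 * τ ^ 2) / t +
        exp 1 * (16 * π ^ 2 * ε ^ 4) + exp (-r' ^ 2 / (16 * τ)) * (64 * π ^ 2 * τ ^ 2) := by
  have h1t : 0 < 1 - t := by linarith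
  have hbt : 0 < (1 - t) / (4 * τ) := by positivity
  have hb1 : 0 < 1 / (4 * τ) := by positivity
  have hb2 : 0 < 1 / (4 * ε ^ 2) := by positivity
  have hb3 : 0 < 1 / (8 * τ) := by positivity
  have hGt := integrable_gaussian_four hbt
  have hG1 := integrable_gaussian_four hb1
  have hG2 := integrable_gaussian_four hb2
  have hG3 := integrable_gaussian_four hb3
  have vt : π ^ 2 / ((1 - t) / (4 * τ)) ^ 2 = 16 * π ^ 2 * τ ^ 2 / (1 - t) ^ 2 := by
    field_simp
    norm_num
  have v1 : π ^ 2 / (1 / (4 * τ)) ^ 2 = 16 * π ^ 2 * τ ^ 2 := by field_simp; ring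
  have v2 : π ^ 2 / (1 / (4 * ε ^ 2)) ^ 2 = 16 * π ^ 2 * ε ^ 4 := by field_simp; ring
  have v3 : π ^ 2 / (1 / (8 * τ)) ^ 2 = 64 * π ^ 2 * τ ^ 2 := by field_simp; ring
  -- the dominating function and its integrability
  have hdom : Integrable (fun y : EuclideanSpace ℝ (Fin 4) ↦
      (exp (-((1 - t) / (4 * τ)) * ‖y‖ ^ 2) - exp (-(1 / (4 * τ)) * ‖y‖ ^ 2)) / t +
        exp 1 * exp (-(1 / (4 * ε ^ 2)) * ‖y‖ ^ 2) +
        exp (-r' ^ 2 / (16 * τ)) * exp (-(1 / (8 * τ)) * ‖y‖ ^ 2)) :=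
    (((hGt.sub' hG1).div_const t).fun_add (hG2.const_mul _)).fun_add (hG3.const_mul _)
  have hdom0 : ∀ y : EuclideanSpace ℝ (Fin 4), 0 ≤
      (exp (-((1 - t) / (4 * τ)) * ‖y‖ ^ 2) - exp (-(1 / (4 * τ)) * ‖y‖ ^ 2)) / t +
        exp 1 * exp (-(1 / (4 * ε ^ 2)) * ‖y‖ ^ 2) +
        exp (-r' ^ 2 / (16 * τ)) * exp (-(1 / (8 * τ)) * ‖y‖ ^ 2) := by
    intro y
    have : exp (-(1 / (4 * τ)) * ‖y‖ ^ 2) ≤ exp (-((1 - t) / (4 * τ)) * ‖y‖ ^ 2) := by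
      rw [exp_le_exp]
      have h0 : 0 ≤ t / (4 * τ) * ‖y‖ ^ 2 := by positivity
      have e : -((1 - t) / (4 * τ)) * ‖y‖ ^ 2 = -(1 / (4 * τ)) * ‖y‖ ^ 2 + t / (4 * τ) * ‖y‖ ^ 2 := by
        ring
      linarith
    have : 0 ≤ (exp (-((1 - t) / (4 * τ)) * ‖y‖ ^ 2) - exp (-(1 / (4 * τ)) * ‖y‖ ^ 2)) / t :=
      div_nonneg (by linarith) ht.le
    positivity
  calc _ ≤ ∫ y in (Metric.ball (0 : EuclideanSpace ℝ (Fin 4)) r' \ Metric.closedBall 0 ε),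
        ((exp (-((1 - t) / (4 * τ)) * ‖y‖ ^ 2) - exp (-(1 / (4 * τ)) * ‖y‖ ^ 2)) / t +
          exp 1 * exp (-(1 / (4 * ε ^ 2)) * ‖y‖ ^ 2) +
          exp (-r' ^ 2 / (16 * τ)) * exp (-(1 / (8 * τ)) * ‖y‖ ^ 2)) := by
        apply integral_mono_of_nonneg
        · refine ae_of_all _ (fun y ↦ ?_)
          have h0 := sq_nonneg (exp (-‖y‖ ^ 2 / (8 * τ)) *
            (smoothTransition (‖y‖ ^ 2 / (2 * ε ^ 2) - 1) *
              smoothTransition (3 - 4 * ‖y‖ ^ 2 / r' ^ 2)))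
          have h1 : (exp (-‖y‖ ^ 2 / (8 * τ)) *
            (smoothTransition (‖y‖ ^ 2 / (2 * ε ^ 2) - 1) *
              smoothTransition (3 - 4 * ‖y‖ ^ 2 / r' ^ 2))) ^ 2 ≤ 1 := by
            refine (profile_sq_le τ ε r' _).trans ?_
            rw [exp_le_one_iff, div_nonpos_iff]; right
            exact ⟨by nlinarith [sq_nonneg ‖y‖], by positivity⟩
          have := Real.log_nonpos h0 h1
          simp only [Pi.zero_apply]
          nlinarith
        · exact hdom.integrableOn
        · exact ae_of_all _ (fun y ↦ negMulLog_profile_sq_le' ht hτ hε hr (sq_nonneg ‖y‖))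
    _ ≤ ∫ y : EuclideanSpace ℝ (Fin 4),
        ((exp (-((1 - t) / (4 * τ)) * ‖y‖ ^ 2) - exp (-(1 / (4 * τ)) * ‖y‖ ^ 2)) / t +
          exp 1 * exp (-(1 / (4 * ε ^ 2)) * ‖y‖ ^ 2) +
          exp (-r' ^ 2 / (16 * τ)) * exp (-(1 / (8 * τ)) * ‖y‖ ^ 2)) :=
        setIntegral_le_integral hdom (ae_of_all _ hdom0)
    _ = _ := by
        rw [integral_add (((hGt.sub' hG1).div_const t).fun_add (hG2.const_mul _)) (hG3.const_mul _),
          integral_add ((hGt.sub' hG1).div_const t) (hG2.const_mul _),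
          integral_div, integral_sub hGt hG1, integral_const_mul, integral_const_mul,
          integral_gaussian_four hbt, integral_gaussian_four hb1, integral_gaussian_four hb2,
          integral_gaussian_four hb3, vt, v1, v2, v3]

/-- `∫ 16 s w'² ≤ τ⁻¹ (16π²τ²/(1-t)² - 16π²τ²)/t + K₁ · e 16π²ε⁴ + K₂ · e π² r'⁴`. [folklore] -/
theorem I1_le {D t τ ε r' : ℝ} (hD : ∀ x, |deriv smoothTransition x| ≤ D) (ht : 0 < t)
    (ht1 : t < 1) (hτ : 0 < τ) (hε : 0 < ε) (hr : 0 < r') (hεr : 16 * ε ^ 2 ≤ r' ^ 2) :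
    ∫ y in (Metric.ball (0 : EuclideanSpace ℝ (Fin 4)) r' \ Metric.closedBall 0 ε),
        16 * ‖y‖ ^ 2 *
          (deriv (fun s : ℝ ↦ exp (-s / (8 * τ)) *
            (smoothTransition (s / (2 * ε ^ 2) - 1) *
              smoothTransition (3 - 4 * s / r' ^ 2))) (‖y‖ ^ 2)) ^ 2 ≤
      1 / τ * ((16 * π ^ 2 * τ ^ 2 / (1 - t) ^ 2 - 16 * π ^ 2 * τ ^ 2) / t) +
        (32 * D ^ 2 / ε ^ 2 + 2 * ε ^ 2 / τ ^ 2) * (exp 1 * (16 * π ^ 2 * ε ^ 4)) +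
        exp (-r' ^ 2 / (8 * τ)) * (512 * D ^ 2 / r' ^ 2 + r' ^ 2 / (2 * τ ^ 2)) *
          (exp 1 * (π ^ 2 * r' ^ 4)) := by
  have h1t : 0 < 1 - t := by linarith
  have hbt : 0 < (1 - t) / (4 * τ) := by positivity
  have hb1 : 0 < 1 / (4 * τ) := by positivity
  have hb2 : 0 < 1 / (4 * ε ^ 2) := by positivity
  have hb4 : 0 < 1 / r' ^ 2 := by positivity
  have hGt := integrable_gaussian_four hbt
  have hG1 := integrable_gaussian_four hb1
  have hG2 := integrable_gaussian_four hb2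
  have hG4 := integrable_gaussian_four hb4
  have vt : π ^ 2 / ((1 - t) / (4 * τ)) ^ 2 = 16 * π ^ 2 * τ ^ 2 / (1 - t) ^ 2 := by
    field_simp
    norm_num
  have v1 : π ^ 2 / (1 / (4 * τ)) ^ 2 = 16 * π ^ 2 * τ ^ 2 := by field_simp; ring
  have v2 : π ^ 2 / (1 / (4 * ε ^ 2)) ^ 2 = 16 * π ^ 2 * ε ^ 4 := by field_simp; ring
  have v4 : π ^ 2 / (1 / r' ^ 2) ^ 2 = π ^ 2 * r' ^ 4 := by field_simp
  have hD0 : 0 ≤ D := (abs_nonneg _).trans (hD 0)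
  set K₁ := 32 * D ^ 2 / ε ^ 2 + 2 * ε ^ 2 / τ ^ 2 with hK₁
  set K₂ := exp (-r' ^ 2 / (8 * τ)) * (512 * D ^ 2 / r' ^ 2 + r' ^ 2 / (2 * τ ^ 2)) with hK₂
  have hdom : Integrable (fun y : EuclideanSpace ℝ (Fin 4) ↦
      1 / τ * ((exp (-((1 - t) / (4 * τ)) * ‖y‖ ^ 2) - exp (-(1 / (4 * τ)) * ‖y‖ ^ 2)) / t) +
        K₁ * (exp 1 * exp (-(1 / (4 * ε ^ 2)) * ‖y‖ ^ 2)) +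
        K₂ * (exp 1 * exp (-(1 / r' ^ 2) * ‖y‖ ^ 2))) :=
    ((((hGt.sub' hG1).div_const t).const_mul _).fun_add ((hG2.const_mul _).const_mul _)).fun_add
      ((hG4.const_mul _).const_mul _)
  have hdom0 : ∀ y : EuclideanSpace ℝ (Fin 4), 0 ≤
      1 / τ * ((exp (-((1 - t) / (4 * τ)) * ‖y‖ ^ 2) - exp (-(1 / (4 * τ)) * ‖y‖ ^ 2)) / t) +
        K₁ * (exp 1 * exp (-(1 / (4 * ε ^ 2)) * ‖y‖ ^ 2)) +
        K₂ * (exp 1 * exp (-(1 / r' ^ 2) * ‖y‖ ^ 2)) := by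
    intro y
    have : exp (-(1 / (4 * τ)) * ‖y‖ ^ 2) ≤ exp (-((1 - t) / (4 * τ)) * ‖y‖ ^ 2) := by
      rw [exp_le_exp]
      have h0 : 0 ≤ t / (4 * τ) * ‖y‖ ^ 2 := by positivity
      have e : -((1 - t) / (4 * τ)) * ‖y‖ ^ 2 = -(1 / (4 * τ)) * ‖y‖ ^ 2 + t / (4 * τ) * ‖y‖ ^ 2 := by
        ring
      linarith
    have : 0 ≤ (exp (-((1 - t) / (4 * τ)) * ‖y‖ ^ 2) - exp (-(1 / (4 * τ)) * ‖y‖ ^ 2)) / t :=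
      div_nonneg (by linarith) ht.le
    have : 0 ≤ K₁ := by positivity
    have : 0 ≤ K₂ := by positivity
    positivity
  calc _ ≤ ∫ y in (Metric.ball (0 : EuclideanSpace ℝ (Fin 4)) r' \ Metric.closedBall 0 ε),
        (1 / τ * ((exp (-((1 - t) / (4 * τ)) * ‖y‖ ^ 2) - exp (-(1 / (4 * τ)) * ‖y‖ ^ 2)) / t) +
          K₁ * (exp 1 * exp (-(1 / (4 * ε ^ 2)) * ‖y‖ ^ 2)) +
          K₂ * (exp 1 * exp (-(1 / r' ^ 2) * ‖y‖ ^ 2))) := by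
        apply integral_mono_of_nonneg
        · exact ae_of_all _ (fun y ↦ by positivity)
        · exact hdom.integrableOn
        · refine ae_restrict_of_forall_mem (measurableSet_annulus ε r') (fun y hy ↦ ?_)
          have hy1 : ‖y‖ < r' := mem_ball_zero_iff.mp hy.1
          have hyr : ‖y‖ ^ 2 ≤ r' ^ 2 := by nlinarith [norm_nonneg y]
          exact gradDensity_le' hD ht hτ hε hr hεr (sq_nonneg ‖y‖) hyr
    _ ≤ ∫ y : EuclideanSpace ℝ (Fin 4),
        (1 / τ * ((exp (-((1 - t) / (4 * τ)) * ‖y‖ ^ 2) - exp (-(1 / (4 * τ)) * ‖y‖ ^ 2)) / t) +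
          K₁ * (exp 1 * exp (-(1 / (4 * ε ^ 2)) * ‖y‖ ^ 2)) +
          K₂ * (exp 1 * exp (-(1 / r' ^ 2) * ‖y‖ ^ 2))) :=
        setIntegral_le_integral hdom (ae_of_all _ hdom0)
    _ = _ := by
        rw [integral_add ((((hGt.sub' hG1).div_const t).const_mul _).fun_add
            ((hG2.const_mul _).const_mul _)) ((hG4.const_mul _).const_mul _),
          integral_add (((hGt.sub' hG1).div_const t).const_mul _) ((hG2.const_mul _).const_mul _),
          integral_const_mul, integral_const_mul, integral_const_mul, integral_const_mul,
          integral_const_mul, integral_div, integral_sub hGt hG1,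
          integral_gaussian_four hbt, integral_gaussian_four hb1, integral_gaussian_four hb2,
          integral_gaussian_four hb4, vt, v1, v2, v4]

/-! ## Error budget: everything is `O(ε²/τ + τ/r'²)` relative to `16π²τ²` -/

/-- Inner-shell budget: `τ (32D²/ε² + 2ε²/τ²) · e 16π²ε⁴ ≤ 16π²τ² (96D² + 1) c` when `ε² ≤ cτ`,
`c ≤ 1/4`. [folklore] -/
theorem budget_inner {D c τ ε : ℝ} (hc : 0 < c) (hc4 : c ≤ 1 / 4) (hτ : 0 < τ) (hε : 0 < ε)
    (hεc : ε ^ 2 ≤ c * τ) :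
    τ * ((32 * D ^ 2 / ε ^ 2 + 2 * ε ^ 2 / τ ^ 2) * (exp 1 * (16 * π ^ 2 * ε ^ 4))) ≤
      16 * π ^ 2 * τ ^ 2 * ((96 * D ^ 2 + 1) * c) := by
  have he3 : exp 1 ≤ 3 := exp_one_lt_three.le
  have hu : 0 < ε ^ 2 := by positivity
  have e1 : τ * ((32 * D ^ 2 / ε ^ 2 + 2 * ε ^ 2 / τ ^ 2) * (exp 1 * (16 * π ^ 2 * ε ^ 4))) =
      exp 1 * (16 * π ^ 2) * (32 * D ^ 2 * ε ^ 2 * τ + 2 * (ε ^ 2) ^ 3 / τ) := by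
    field_simp
  have h1 : 32 * D ^ 2 * ε ^ 2 * τ ≤ 32 * D ^ 2 * (c * τ) * τ := by gcongr
  have h2 : (ε ^ 2) ^ 3 ≤ (c * τ) ^ 3 := pow_le_pow_left₀ hu.le hεc 3
  have h3 : 2 * (ε ^ 2) ^ 3 / τ ≤ 2 * (c * τ) ^ 3 / τ := by gcongr
  have e2 : 2 * (c * τ) ^ 3 / τ = 2 * c ^ 3 * τ ^ 2 := by field_simp
  have h4 : 32 * D ^ 2 * ε ^ 2 * τ + 2 * (ε ^ 2) ^ 3 / τ ≤ τ ^ 2 * (32 * D ^ 2 * c + 2 * c ^ 3) := by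
    rw [e2] at h3; nlinarith
  have h5 : 2 * c ^ 3 ≤ c / 3 := by nlinarith [mul_pos hc hc]
  have hX : 0 ≤ 32 * D ^ 2 * ε ^ 2 * τ + 2 * (ε ^ 2) ^ 3 / τ := by positivity
  rw [e1]
  calc exp 1 * (16 * π ^ 2) * (32 * D ^ 2 * ε ^ 2 * τ + 2 * (ε ^ 2) ^ 3 / τ)
      ≤ 3 * (16 * π ^ 2) * (τ ^ 2 * (32 * D ^ 2 * c + 2 * c ^ 3)) := by
        apply mul_le_mul _ h4 hX (by positivity)
        exact mul_le_mul_of_nonneg_right he3 (by positivity)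
    _ ≤ 3 * (16 * π ^ 2) * (τ ^ 2 * (32 * D ^ 2 * c + c / 3)) := by gcongr
    _ = 16 * π ^ 2 * τ ^ 2 * ((96 * D ^ 2 + 1) * c) := by ring

/-- Outer-shell budget:
`τ e^{-r'²/8τ} (512D²/r'² + r'²/2τ²) · e π² r'⁴ ≤ 16π²τ² (12288D² + 9216) c` when `τ ≤ c r'²`.
[folklore] -/
theorem budget_outer {D c τ r' : ℝ} (hc : 0 < c) (hτ : 0 < τ) (hr : 0 < r') (hτc : τ ≤ c * r' ^ 2) :
    τ * (exp (-r' ^ 2 / (8 * τ)) * (512 * D ^ 2 / r' ^ 2 + r' ^ 2 / (2 * τ ^ 2)) *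
        (exp 1 * (π ^ 2 * r' ^ 4))) ≤
      16 * π ^ 2 * τ ^ 2 * ((12288 * D ^ 2 + 9216) * c) := by
  have he3 : exp 1 ≤ 3 := exp_one_lt_three.le
  have hR : 0 < r' ^ 2 := by positivity
  have hτR : τ / r' ^ 2 ≤ c := by rwa [div_le_iff₀ hR]
  have X1 := mul_exp_neg_div_eight_le hR hτ
  have X3 := pow_three_mul_exp_neg_div_eight_le hR hτ
  have e1 : τ * (exp (-r' ^ 2 / (8 * τ)) * (512 * D ^ 2 / r' ^ 2 + r' ^ 2 / (2 * τ ^ 2)) *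
      (exp 1 * (π ^ 2 * r' ^ 4))) =
      exp 1 * π ^ 2 * τ * (512 * D ^ 2 * (r' ^ 2 * exp (-r' ^ 2 / (8 * τ))) +
        (r' ^ 2) ^ 3 * exp (-r' ^ 2 / (8 * τ)) / (2 * τ ^ 2)) := by
    field_simp
  have h1 : 512 * D ^ 2 * (r' ^ 2 * exp (-r' ^ 2 / (8 * τ))) ≤ 512 * D ^ 2 * (128 * τ ^ 2 / r' ^ 2) := by
    gcongr
  have h2 : (r' ^ 2) ^ 3 * exp (-r' ^ 2 / (8 * τ)) / (2 * τ ^ 2) ≤ 98304 * τ ^ 4 / r' ^ 2 / (2 * τ ^ 2) := by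
    gcongr
  have e2 : 512 * D ^ 2 * (128 * τ ^ 2 / r' ^ 2) + 98304 * τ ^ 4 / r' ^ 2 / (2 * τ ^ 2) =
      τ ^ 2 * (τ / r' ^ 2) * (65536 * D ^ 2 + 49152) / τ := by
    field_simp
    ring
  have h3 : τ ^ 2 * (τ / r' ^ 2) * (65536 * D ^ 2 + 49152) / τ ≤
      τ ^ 2 * c * (65536 * D ^ 2 + 49152) / τ := by gcongr
  have hX : 0 ≤ 512 * D ^ 2 * (r' ^ 2 * exp (-r' ^ 2 / (8 * τ))) +
      (r' ^ 2) ^ 3 * exp (-r' ^ 2 / (8 * τ)) / (2 * τ ^ 2) := by positivity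
  rw [e1]
  calc exp 1 * π ^ 2 * τ * (512 * D ^ 2 * (r' ^ 2 * exp (-r' ^ 2 / (8 * τ))) +
        (r' ^ 2) ^ 3 * exp (-r' ^ 2 / (8 * τ)) / (2 * τ ^ 2))
      ≤ 3 * π ^ 2 * τ * (τ ^ 2 * c * (65536 * D ^ 2 + 49152) / τ) := by
        apply mul_le_mul _ _ hX (by positivity)
        · gcongr
        · linarith
    _ = 16 * π ^ 2 * τ ^ 2 * ((12288 * D ^ 2 + 9216) * c) := by field_simp; ring

end ConeAnnulus

/-- **Registered sub-goal `stub_coneAnnulusIntegralEstimates`** of `stub_coneAnnulusArithmetic`: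
the two-sided estimate `16π²τ² - e·16π²ε⁴ - e^{-r'²/16τ}·64π²τ² ≤ I₀ ≤ 16π²τ²`. [folklore] -/
theorem stub_coneAnnulusIntegralEstimates :
    ∀ (τ ε r' : ℝ), 0 < τ → 0 < ε → 0 < r' →
      16 * Real.pi ^ 2 * τ ^ 2 - Real.exp 1 * (16 * Real.pi ^ 2 * ε ^ 4) -
            Real.exp (-r' ^ 2 / (16 * τ)) * (64 * Real.pi ^ 2 * τ ^ 2) ≤
          (∫ y in (Metric.ball (0 : EuclideanSpace ℝ (Fin 4)) r' \ Metric.closedBall 0 ε),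
            (Real.exp (-‖y‖ ^ 2 / (8 * τ)) *
              (Real.smoothTransition (‖y‖ ^ 2 / (2 * ε ^ 2) - 1) *
                Real.smoothTransition (3 - 4 * ‖y‖ ^ 2 / r' ^ 2))) ^ 2 ∂MeasureTheory.volume) ∧
        (∫ y in (Metric.ball (0 : EuclideanSpace ℝ (Fin 4)) r' \ Metric.closedBall 0 ε),
            (Real.exp (-‖y‖ ^ 2 / (8 * τ)) *
              (Real.smoothTransition (‖y‖ ^ 2 / (2 * ε ^ 2) - 1) *
                Real.smoothTransition (3 - 4 * ‖y‖ ^ 2 / r' ^ 2))) ^ 2 ∂MeasureTheory.volume) ≤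
          16 * Real.pi ^ 2 * τ ^ 2 :=
  fun _ ε r' hτ hε hr ↦ ⟨ConeAnnulus.I0_ge hτ hε hr, ConeAnnulus.I0_le ε r' hτ⟩

end Summit.SmoothPoincare4.SmoothPoincare4.Theorems.SubcylindricalRecognition.AncientSphereRigidity
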